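import Summits.ResolutionOfSingularities.ResolutionOfSingularities.Theorems.FrobeniusLadderFInjectiveMacaulayficationSopFrobeniusPower
import HarnessLib

/-!
# Fedder's test for `(x + y + z)^(p−1)` with a minimal small monomial `y = ε·∏ sᵢ^(eᵢ)`, `eᵢ ≤ 1`
# (BED Ω₁ GLOBAL PATCH, F6 v2 §2: the per-code two-coefficient facts `(u w₀ − v)^(p−1) ∉ 𝔪^[p]`, `u^(p−1) ∉ 𝔪^[p]`, `v^(p−1) ∉ 𝔪^[p]` of the pencil charts are all instances;
# crux `FInjectiveMacaulayfication` stmt-ResolutionOfSingularities-15315, chain w45a; seat res-L1-w45a-stub-3 g15)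

[OURS · L1 W4.5a] Support file (`--supports stmt-ResolutionOfSingularities-15315 --as helper`); theorems only; GENERIC commutative algebra; no named fact; NOT a statement of any
manuscript; nothing of the crux is proved. AI-written (AI review is weaker than expert review).

`(R, 𝔪)` regular local of characteristic `p`, `s` a regular system of parameters, monomials `∏ s[i]^(e i)` (exponents by position).
* `prod_pow_pow` — `(∏ s[i]^(a i))^k = ∏ s[i]^(k·a i)`; `mul_monomial_mem_frobeniusPower_of_le` — `r·∏ s[i]^(a i) ∈ 𝔪^[p]` once some `a i₀ ≥ p`;
* ★★ `trinomial_pow_not_mem_frobeniusPower` — if `y = ε·∏ s[i]^(e i)` with `ε` a unit and all `e i ≤ 1`, and every mixed product `x^j y^k z^l` (`j + k + l = p − 1`, `(j, l) ≠ (0, 0)`)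
  multiplied by the complementary monomial `∏ s[i]^((p−1)(1 − e i))` lies in `𝔪^[p]`, then `(x + y + z)^(p−1) ∉ 𝔪^[p]` (✓ `SopFrobeniusPower.unit_mul_monomial_add_not_mem_frobeniusPower`);
* `binomial_pow_not_mem_frobeniusPower` (`z = 0`) and `unit_mul_monomial_pow_not_mem_frobeniusPower` (`x = z = 0`).
[cite: Fedder1983, Prop. 1.7; HunekeSwanson2006, proof of Thm. 13.1.2 (6)]
-/

set_option linter.dupNamespace false

namespace Summit.ResolutionOfSingularities.ResolutionOfSingularities.Theorems.FInjectiveMacaulayfication.PencilFedderTrinomial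

open IsLocalRing Literature.RingTheory.TightClosure Literature.AlgebraicGeometry.Resolution
open Summit.ResolutionOfSingularities.ResolutionOfSingularities.Theorems.FInjectiveMacaulayfication SopFrobeniusPower

universe u

variable (p : ℕ) [Fact p.Prime]

section Monomials

variable {R : Type u} [CommRing R]

/-- `(∏ s[i]^(a i))^k = ∏ s[i]^(k·a i)`. [folklore] -/
theorem prod_pow_pow (s : List R) (a : ℕ → ℕ) (k : ℕ) :
    (∏ i : Fin s.length, s[i] ^ a i) ^ k = ∏ i : Fin s.length, s[i] ^ (k * a i) := by
  rw [← Finset.prod_pow]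
  refine Finset.prod_congr rfl fun i _ => ?_
  rw [← pow_mul, mul_comm]

omit [Fact p.Prime] in
/-- `r·∏ s[i]^(a i) ∈ 𝔪^[p]` as soon as some exponent `a i₀ ≥ p` (`𝔪 = (s)`). [folklore] -/
theorem mul_monomial_mem_frobeniusPower_of_le [IsLocalRing R] [CharP R p] (s : List R) (hspan : Ideal.ofList s = maximalIdeal R)
    (a : ℕ → ℕ) (i₀ : Fin s.length) (hi₀ : p ≤ a i₀) (r : R) :
    r * ∏ i : Fin s.length, s[i] ^ a i ∈ frobeniusPower p (maximalIdeal R) :=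
  Ideal.mul_mem_left _ _ (monomial_mem_frobeniusPower_of_le p s hspan a i₀ hi₀)

end Monomials

section Trinomial

variable {R : Type u} [CommRing R] [IsRegularLocalRing R] [CharP R p]

/-- ★★ **`(x + y + z)^(p−1) ∉ 𝔪^[p]` FROM A MINIMAL SMALL MONOMIAL `y`.** `s` a regular system of parameters, `y = ε·∏ s[i]^(e i)` with `ε` a unit and all `e i ≤ 1`; if every mixed product
`x^j y^k z^l` (`j + k + l = p − 1`, `j ≠ 0` or `l ≠ 0`) times `∏ s[i]^((p−1)(1 − e i))` lies in `𝔪^[p]`, then `(x + y + z)^(p−1) ∉ 𝔪^[p]`. [cite: Fedder1983, Prop. 1.7] -/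
theorem trinomial_pow_not_mem_frobeniusPower (s : List R) (hspan : Ideal.ofList s = maximalIdeal R) (hlen : (s.length : WithBot ℕ∞) = ringKrullDim R)
    (x y z ε : R) (e : ℕ → ℕ) (he : ∀ i, e i ≤ 1) (hε : IsUnit ε) (hy : y = ε * ∏ i : Fin s.length, s[i] ^ e i)
    (H : ∀ j k l : ℕ, j + k + l = p - 1 → (j ≠ 0 ∨ l ≠ 0) →
      x ^ j * y ^ k * z ^ l * ∏ i : Fin s.length, s[i] ^ ((p - 1) * (1 - e i)) ∈ frobeniusPower p (maximalIdeal R)) :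
    (x + y + z) ^ (p - 1) ∉ frobeniusPower p (maximalIdeal R) := by
  have hp1 : 1 ≤ p - 1 := by have := (Fact.out : p.Prime).two_le; omega
  -- the complementary monomial
  have hcomp : ∀ i : ℕ, p - 1 - (p - 1) * e i = (p - 1) * (1 - e i) := by
    intro i
    rcases Nat.le_one_iff_eq_zero_or_eq_one.mp (he i) with h | h <;> rw [h] <;> simp
  -- split off the pure `y^(p-1)` term
  set M : R := ∏ i : Fin s.length, s[i] ^ ((p - 1) * (1 - e i)) with hM
  set G : R := (x + y + z) ^ (p - 1) - y ^ (p - 1) with hG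
  have hy' : y ^ (p - 1) = ε ^ (p - 1) * ∏ i : Fin s.length, s[i] ^ ((p - 1) * e i) := by
    rw [hy, mul_pow, prod_pow_pow]
  have heq : (x + y + z) ^ (p - 1) = ε ^ (p - 1) * (∏ i : Fin s.length, s[i] ^ ((p - 1) * e i)) + G := by
    rw [hG, hy']; ring
  rw [heq]
  refine unit_mul_monomial_add_not_mem_frobeniusPower p s hspan hlen (fun i => (p - 1) * e i) (fun i => ?_) (ε ^ (p - 1)) (hε.pow _) G ?_
  · calc (p - 1) * e i ≤ (p - 1) * 1 := Nat.mul_le_mul_left _ (he i)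
      _ = p - 1 := mul_one _
  -- `G · M ∈ 𝔪^[p]`: expand `((x + z) + y)^(p-1)` and use `H` termwise
  have hM' : (∏ i : Fin s.length, s[i] ^ (p - 1 - (p - 1) * e i)) = M := by
    rw [hM]; exact Finset.prod_congr rfl fun i _ => by rw [hcomp]
  rw [hM']
  have hexp : (x + y + z) ^ (p - 1) = ∑ k ∈ Finset.range (p - 1 + 1), y ^ k * (x + z) ^ (p - 1 - k) * ((p - 1).choose k : R) := by
    rw [show x + y + z = y + (x + z) by ring, add_pow]
  have hsplit : G = ∑ k ∈ Finset.range (p - 1), y ^ k * (x + z) ^ (p - 1 - k) * ((p - 1).choose k : R) := by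
    rw [hG, hexp, Finset.sum_range_succ, Nat.choose_self, Nat.cast_one, mul_one, Nat.sub_self, pow_zero, mul_one, add_sub_cancel_right]
  rw [hsplit, Finset.sum_mul]
  refine Ideal.sum_mem _ fun k hk => ?_
  rw [Finset.mem_range] at hk
  -- expand `(x + z)^(p-1-k)`
  rw [add_pow, Finset.mul_sum, Finset.sum_mul, Finset.sum_mul]
  refine Ideal.sum_mem _ fun j hj => ?_
  rw [Finset.mem_range] at hj
  have hterm := H j k (p - 1 - k - j) (by omega) (by omega)
  have : y ^ k * (x ^ j * z ^ (p - 1 - k - j) * ((p - 1 - k).choose j : R)) * ((p - 1).choose k : R) * M =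
      (((p - 1 - k).choose j : R) * ((p - 1).choose k : R)) * (x ^ j * y ^ k * z ^ (p - 1 - k - j) * M) := by ring
  rw [this]
  exact Ideal.mul_mem_left _ _ hterm

/-- ★ The binomial case `z = 0`: `(x + y)^(p−1) ∉ 𝔪^[p]` if `y = ε·∏ s[i]^(e i)` (`e ≤ 1`, `ε` unit) and `x^j y^k ∏ s[i]^((p−1)(1−e i)) ∈ 𝔪^[p]` for `j ≥ 1`, `j + k = p − 1`. [cite: Fedder1983, Prop. 1.7] -/
theorem binomial_pow_not_mem_frobeniusPower (s : List R) (hspan : Ideal.ofList s = maximalIdeal R) (hlen : (s.length : WithBot ℕ∞) = ringKrullDim R)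
    (x y ε : R) (e : ℕ → ℕ) (he : ∀ i, e i ≤ 1) (hε : IsUnit ε) (hy : y = ε * ∏ i : Fin s.length, s[i] ^ e i)
    (H : ∀ j k : ℕ, j + k = p - 1 → j ≠ 0 → x ^ j * y ^ k * ∏ i : Fin s.length, s[i] ^ ((p - 1) * (1 - e i)) ∈ frobeniusPower p (maximalIdeal R)) :
    (x + y) ^ (p - 1) ∉ frobeniusPower p (maximalIdeal R) := by
  have h := trinomial_pow_not_mem_frobeniusPower p s hspan hlen x y 0 ε e he hε hy (fun j k l hjkl hjl => ?_)
  · rwa [add_zero] at h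
  · rcases Nat.eq_zero_or_pos l with rfl | hl
    · rw [pow_zero, mul_one]
      exact H j k (by omega) (by omega)
    · rw [zero_pow hl.ne', mul_zero, zero_mul]
      exact Ideal.zero_mem _

/-- ★ A unit multiple of a squarefree monomial: `(ε·∏ s[i]^(e i))^(p−1) ∉ 𝔪^[p]` for `e ≤ 1`. [cite: Fedder1983, Prop. 1.7] -/
theorem unit_mul_monomial_pow_not_mem_frobeniusPower (s : List R) (hspan : Ideal.ofList s = maximalIdeal R) (hlen : (s.length : WithBot ℕ∞) = ringKrullDim R)
    (y ε : R) (e : ℕ → ℕ) (he : ∀ i, e i ≤ 1) (hε : IsUnit ε) (hy : y = ε * ∏ i : Fin s.length, s[i] ^ e i) :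
    y ^ (p - 1) ∉ frobeniusPower p (maximalIdeal R) := by
  have h := binomial_pow_not_mem_frobeniusPower p s hspan hlen 0 y ε e he hε hy (fun j k hjk hj => ?_)
  · rwa [zero_add] at h
  · rw [zero_pow hj, zero_mul, zero_mul]
    exact Ideal.zero_mem _

end Trinomial

end Summit.ResolutionOfSingularities.ResolutionOfSingularities.Theorems.FInjectiveMacaulayfication.PencilFedderTrinomial
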